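import Mathlib
import HarnessLib
import Summits.Ventures.LatticeQCDFlow.Scaling.ChiSqContraction
import Summits.Ventures.LatticeQCDFlow.Exactness.LazyRelaxationLagLaw
import Summits.Ventures.LatticeQCDFlow.Scaling.GeneralLayerDissipation
import Summits.Ventures.LatticeQCDFlow.Scaling.TiltedProtocolMass

/-!
# GeneralLayerLagLaw — the lag law for ARBITRARY relaxation layers, I: the identity
# `⟨W⟩ − ΔF = KL_qs + Σ_j δ_j·lag_j` for any layers, the Cauchy–Schwarz lag bound, and the
# `χ²`-recursion = row 8's lag recursion `e_{k+1} = θ(e_k + d_k)`; any grid: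
# `|⟨W⟩ − ΔF − KL_qs| ≤ Σ_j d_j·lagSeq θ d j`

HONEST FRAMING: exact (Metropolis-corrected) sampling algorithms for lattice gauge theory;
figures of merit are autocorrelation/cost numbers at stated couplings and volumes; no
continuum-physics claim.

Venture `LatticeQCDFlow` (cell pub-lqcd), topic `Scaling`; FANOUT row 19 (`su2-snf`, GEN-5).
OUR WORK (elementary finite sums), nothing here is cited as a fact.  Setting of row 8's lag law
(`Exactness/LazyRelaxationLagLaw.lean`): finite configuration space, the stepwise LINEAR protocol
`S_c = S₀ + c • D` along a grid `c_0, …, c_n` started in equilibrium at `c_0`; after the switch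
`c_k → c_{k+1}` (work increment `(c_{k+1} − c_k)·D`) a relaxation layer `P_k` with unit row sums,
targeting `π_{c_{k+1}}`, acts.  Row 8 solved the model EXACTLY for the LAZY layers `ε·I + (1 − ε)·Π`
(`lazyDissipation_eq`; uniform grid: `⟨W⟩ − ΔF ≤ KL_qs + (ε/(1−ε))(⟨D⟩_0 − ⟨D⟩_1)/n`, i.e.
`≤ 2τ_int × floor + O(n⁻²)`) and left "the production heat-bath / over-relaxation kernels" open
(`Exactness/LazyRelaxationESS`, docstring).  This file and its sequel
`Scaling/GeneralLayerLagLawUniform.lean` prove the lag law AS A TWO-SIDED BOUND for EVERY family of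
layers, the only datum being a `χ²`-contraction coefficient (`Scaling/ChiSqContraction.lean`:
`ChiSqContracts (P k) π_{c_{k+1}} ρ`, discharged with `ρ = λ⋆(P_k) = 1 − 1/t_rel` for every
reversible irreducible layer by the Literature's Levin–Peres variance decay).  Here:

* `chiSqDiv_eq_inv_essFrac_sub_one`, `lawVariance_eq_varLaw` — the Literature's Pearson `χ²` /
  variance ARE theory-2's `1/ESS − 1` / `varLaw`; `varD_le_sq_of_osc` (`Var_c(D) ≤ ΔD²/2` if
  `|D x − D y| ≤ ΔD`);
* ONE SWITCH on the `χ²` scale (`M = |c' − c|·ΔD`): `gibbsLaw_linAction_le_exp_mul`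
  (`π_c ≤ e^{M} π_{c'}`), **`sqrt_chiSqDiv_gibbsLaw_linAction_le`**
  (`√χ²(π_c ‖ π_{c'}) ≤ e^{M/2}·|c' − c|·√Var_c(D)`, from theory-2's `χ² ≤ e^{M}·Var(log w)`);
* (`layerDissipation`, `layerLag`, the identity `layerDissipation_eq` —
  `⟨W⟩ − ΔF = KL_qs + Σ_{j<n} (c_{j+1} − c_j)·layerLag_j` — and `kl_path_layer_eq` live in
  `Scaling/GeneralLayerDissipation` (GEN-9 split; shared with `Scaling/EntropyLagLaw`));
  `layerDissipation_perfect` (`P_k = Π`: `⟨W⟩ − ΔF = KL_qs`, row 8's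
  `kl_path_perfect_eq_qsDissipation` recovered);
* **`abs_layerLag_le`** — `|layerLag_j| ≤ √χ²(μ_j ‖ π_{c_j}) · √Var_{c_j}(D)`;
* **`sqrt_chiSqDiv_evolveLaw_le_lagSeq`** — THE `χ²`-RECURSION IS THE LAG RECURSION: if
  `|D x − D y| ≤ ΔD`, every `P_k` contracts `χ²` towards `π_{c_{k+1}}` with `ρ ≥ 0` and
  `ρ·e^{|c_{k+1} − c_k|ΔD/2} ≤ θ`, then `√χ²(μ_j ‖ π_{c_j}) ≤ lagSeq θ d j` (row 8's `lagSeq`,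
  laziness `↦ θ`, drops `d_k = |c_{k+1} − c_k|·√Var_{c_k}(D)`): a switch moves the reference law
  by `≤ e^{M_k/2} d_k` and dilates old distances by `≤ e^{M_k/2}`, a layer shrinks them by `ρ`;
* **`abs_layerDissipation_sub_qs_le`** (any grid) — `|⟨W⟩ − ΔF − KL_qs| ≤ Σ_{j<n} d_j·lagSeq θ d j`.

The closed form along the uniform grid (`≤ (θ/(1−θ))·σ̄²/n`, `θ = ρ e^{ΔD/(2n)}`), the floor
corollaries and the lazy / reversible instances are in the sequel.  Convention (here and in the
sequels): layer families are indexed by every `k : ℕ` and hypotheses are stated for every `k`;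
layers beyond the horizon are never applied — extend a finite family by perfect relaxation onto
the next target, which meets every hypothesis used here (`chiSqContracts_perfect`, `ρ = 0`).  NOT CLAIMED: anything about
the path-space ESS of general layers (mean work only); any value of `ρ` for a lattice kernel.
-/

namespace Summit.Ventures.LatticeQCDFlow.Scaling

open Finset
open Literature.Probability.MarkovChains (IsRowStochastic stepLaw DetailedBalance IsIrreducible
  lambdaStar lawVariance lawMean lambdaStar_nonneg)
open Literature.Probability.ImportanceSampling (chiSqDiv chiSqDiv_def chiSqDiv_eq_sum_sq_div)
open Summit.Ventures.LatticeQCDFlow.Exactness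
open Summit.Ventures.LatticeQCDFlow.Theory2

variable {X : Type*} [Fintype X]

/-! ## `χ²` between two Gibbs laws of the linear family -/

/-- `Var` of the Literature (`lawVariance`) is theory-2's `varLaw` on a normalised law. -/
theorem lawVariance_eq_varLaw {p : X → ℝ} (hp1 : ∑ x, p x = 1) (f : X → ℝ) :
    lawVariance p f = varLaw p f := by
  rw [varLaw_eq_sum_sq_dev hp1]
  rfl

/-- **Universal variance bound**: if the switch observable oscillates by at most `ΔD`
(`|D x − D y| ≤ ΔD`), then `Var_c(D) ≤ ΔD²/2` at every `c` (pair representation). -/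
theorem varD_le_sq_of_osc [Nonempty X] (S₀ D : X → ℝ) {ΔD : ℝ} (hD : ∀ x y, |D x - D y| ≤ ΔD)
    (c : ℝ) : varD S₀ D c ≤ ΔD ^ 2 / 2 := by
  unfold varD
  rw [varLaw_eq_half_sum (sum_gibbsLaw _)]
  have h : ∑ x, ∑ y, gibbsLaw (linAction S₀ D c) x * gibbsLaw (linAction S₀ D c) y * (D x - D y) ^ 2
      ≤ ∑ x, ∑ y, gibbsLaw (linAction S₀ D c) x * gibbsLaw (linAction S₀ D c) y * ΔD ^ 2 := by
    refine sum_le_sum fun x _ => sum_le_sum fun y _ => mul_le_mul_of_nonneg_left ?_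
      (mul_nonneg (gibbsLaw_pos _ x).le (gibbsLaw_pos _ y).le)
    calc (D x - D y) ^ 2 = |D x - D y| ^ 2 := (sq_abs _).symm
      _ ≤ ΔD ^ 2 := pow_le_pow_left₀ (abs_nonneg _) (hD x y) 2
  have e : ∑ x, ∑ y, gibbsLaw (linAction S₀ D c) x * gibbsLaw (linAction S₀ D c) y * ΔD ^ 2
      = ΔD ^ 2 := by
    calc ∑ x, ∑ y, gibbsLaw (linAction S₀ D c) x * gibbsLaw (linAction S₀ D c) y * ΔD ^ 2
        = ∑ x, gibbsLaw (linAction S₀ D c) x * ((∑ y, gibbsLaw (linAction S₀ D c) y) * ΔD ^ 2) := by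
          refine sum_congr rfl fun x _ => ?_
          rw [sum_mul, mul_sum]
          exact sum_congr rfl fun y _ => by ring
      _ = ΔD ^ 2 := by rw [sum_gibbsLaw, one_mul, ← sum_mul, sum_gibbsLaw, one_mul]
  linarith

/-- Between two Gibbs laws of the linear family the log-ratio differences are
`(c' − c)·(D y − D z)`. -/
theorem logW_gibbsLaw_linAction_sub [Nonempty X] (S₀ D : X → ℝ) (c c' : ℝ) (y z : X) :
    logW (gibbsLaw (linAction S₀ D c)) (gibbsLaw (linAction S₀ D c')) y
      - logW (gibbsLaw (linAction S₀ D c)) (gibbsLaw (linAction S₀ D c')) z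
      = (c' - c) * (D y - D z) := by
  unfold logW gibbsLaw
  have hZ := partitionFn_pos (linAction S₀ D c)
  have hZ' := partitionFn_pos (linAction S₀ D c')
  rw [Real.log_div (div_pos (Real.exp_pos _) hZ).ne' (div_pos (Real.exp_pos _) hZ').ne',
    Real.log_div (div_pos (Real.exp_pos _) hZ).ne' (div_pos (Real.exp_pos _) hZ').ne',
    Real.log_div (Real.exp_pos _).ne' hZ.ne', Real.log_div (Real.exp_pos _).ne' hZ'.ne',
    Real.log_div (Real.exp_pos _).ne' hZ.ne', Real.log_div (Real.exp_pos _).ne' hZ'.ne',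
    Real.log_exp, Real.log_exp, Real.log_exp, Real.log_exp]
  simp only [linAction]
  ring

/-- **One switch of the linear protocol, (i): the reference law moves boundedly.**  With
`|D x − D y| ≤ ΔD`: `π_c ≤ e^{|c'−c|ΔD}·π_{c'}` pointwise. -/
theorem gibbsLaw_linAction_le_exp_mul [Nonempty X] (S₀ D : X → ℝ) {ΔD : ℝ}
    (hD : ∀ x y, |D x - D y| ≤ ΔD) (c c' : ℝ) (x : X) :
    gibbsLaw (linAction S₀ D c) x
      ≤ Real.exp (|c' - c| * ΔD) * gibbsLaw (linAction S₀ D c') x := by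
  refine le_exp_mul_of_abs_log_sub_le (gibbsLaw_pos _) (gibbsLaw_pos _) (sum_gibbsLaw _)
    (sum_gibbsLaw _) (fun y z => ?_) x
  have h := logW_gibbsLaw_linAction_sub S₀ D c c' y z
  unfold logW at h
  rw [h, abs_mul]
  exact mul_le_mul_of_nonneg_left (hD y z) (abs_nonneg _)

/-- **One switch of the linear protocol, (ii): its own `χ²` cost.**
`√χ²(π_c ‖ π_{c'}) ≤ e^{|c'−c|ΔD/2}·|c' − c|·√Var_c(D)` (theory-2's `χ² ≤ e^{M} Var(log w)` for a
log-weight oscillating by `M = |c'−c|ΔD`, whose variance is `(c'−c)² Var_c(D)`). -/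
theorem sqrt_chiSqDiv_gibbsLaw_linAction_le [Nonempty X] (S₀ D : X → ℝ) {ΔD : ℝ}
    (hD : ∀ x y, |D x - D y| ≤ ΔD) (c c' : ℝ) :
    Real.sqrt (chiSqDiv (gibbsLaw (linAction S₀ D c)) (gibbsLaw (linAction S₀ D c')))
      ≤ Real.exp (|c' - c| * ΔD / 2) * (|c' - c| * Real.sqrt (varD S₀ D c)) := by
  have hM : ∀ y z, |logW (gibbsLaw (linAction S₀ D c)) (gibbsLaw (linAction S₀ D c')) y
      - logW (gibbsLaw (linAction S₀ D c)) (gibbsLaw (linAction S₀ D c')) z| ≤ |c' - c| * ΔD := by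
    intro y z
    rw [logW_gibbsLaw_linAction_sub, abs_mul]
    exact mul_le_mul_of_nonneg_left (hD y z) (abs_nonneg _)
  have hv : varLaw (gibbsLaw (linAction S₀ D c))
        (logW (gibbsLaw (linAction S₀ D c)) (gibbsLaw (linAction S₀ D c')))
      = (c' - c) ^ 2 * varD S₀ D c := by
    unfold varD
    rw [← varLaw_const_mul (sum_gibbsLaw _)]
    refine varLaw_congr_pair (sum_gibbsLaw _) fun y z => ?_
    rw [logW_gibbsLaw_linAction_sub]
    ring
  have hchi : chiSqDiv (gibbsLaw (linAction S₀ D c)) (gibbsLaw (linAction S₀ D c'))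
      ≤ Real.exp (|c' - c| * ΔD) * ((c' - c) ^ 2 * varD S₀ D c) := by
    rw [chiSqDiv_eq_inv_essFrac_sub_one (gibbsLaw_pos _) (sum_gibbsLaw _) (sum_gibbsLaw _), ← hv]
    exact chiSq_le_exp_mul_varLaw (gibbsLaw_pos _) (gibbsLaw_pos _) (sum_gibbsLaw _)
      (sum_gibbsLaw _) hM
  have h0 : 0 ≤ Real.exp (|c' - c| * ΔD / 2) * (|c' - c| * Real.sqrt (varD S₀ D c)) := by
    positivity
  calc Real.sqrt (chiSqDiv (gibbsLaw (linAction S₀ D c)) (gibbsLaw (linAction S₀ D c')))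
      ≤ Real.sqrt (Real.exp (|c' - c| * ΔD) * ((c' - c) ^ 2 * varD S₀ D c)) :=
        Real.sqrt_le_sqrt hchi
    _ = Real.exp (|c' - c| * ΔD / 2) * (|c' - c| * Real.sqrt (varD S₀ D c)) := by
        rw [← Real.sqrt_sq h0]
        congr 1
        have e2 : Real.exp (|c' - c| * ΔD / 2) ^ 2 = Real.exp (|c' - c| * ΔD) := by
          rw [← Real.exp_nat_mul]; congr 1; push_cast; ring
        rw [mul_pow, mul_pow, e2, sq_abs, Real.sq_sqrt (varD_nonneg S₀ D c)]

/-! ## Perfect relaxation -/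

/-- PERFECT RELAXATION (`P_k = Π_{c_{k+1}}`): every marginal is the equilibrium law, … -/
theorem evolveLaw_perfect [Nonempty X] (S₀ D : X → ℝ) (c : ℕ → ℝ) :
    ∀ j, evolveLaw (fun k _ y => gibbsLaw (linAction S₀ D (c (k + 1))) y)
        (gibbsLaw (linAction S₀ D (c 0))) j
      = gibbsLaw (linAction S₀ D (c j))
  | 0 => rfl
  | j + 1 => by
      rw [evolveLaw_succ, evolveLaw_perfect S₀ D c j]
      exact stepLaw_perfect _ (sum_gibbsLaw _)

/-- … so `⟨W⟩ − ΔF = KL_qs` (row 8's `kl_path_perfect_eq_qsDissipation` /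
`lazyDissipation_zero`, recovered for the general-layer bookkeeping). -/
theorem layerDissipation_perfect [Nonempty X] (S₀ D : X → ℝ) (c : ℕ → ℝ) (n : ℕ) :
    layerDissipation S₀ D c (fun k _ y => gibbsLaw (linAction S₀ D (c (k + 1))) y) n
      = qsDissipation S₀ D c n := by
  rw [layerDissipation_eq S₀ D c _ (fun k x => sum_gibbsLaw _) n]
  have h0 : ∀ j, layerLag S₀ D c (fun k _ y => gibbsLaw (linAction S₀ D (c (k + 1))) y) j = 0 := by
    intro j
    unfold layerLag
    rw [evolveLaw_perfect S₀ D c j]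
    simp [meanD, gibbsMean]
  simp [h0]

/-! ## The lag bound and the `χ²` recursion -/

/-- **`|layerLag_j| ≤ √χ²(μ_j ‖ π_{c_j}) · √Var_{c_j}(D)`** (Cauchy–Schwarz). -/
theorem abs_layerLag_le [Nonempty X] (S₀ D : X → ℝ) (c : ℕ → ℝ) (P : ℕ → X → X → ℝ)
    (hP : ∀ k x, ∑ y, P k x y = 1) (j : ℕ) :
    |layerLag S₀ D c P j|
      ≤ Real.sqrt (chiSqDiv (evolveLaw P (gibbsLaw (linAction S₀ D (c 0))) j)
            (gibbsLaw (linAction S₀ D (c j))))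
        * Real.sqrt (varD S₀ D (c j)) := by
  have hmass : ∑ y, evolveLaw P (gibbsLaw (linAction S₀ D (c 0))) j y = 1 := by
    rw [sum_evolveLaw P hP, sum_gibbsLaw]
  have h := abs_sum_mul_sub_sum_mul_le (gibbsLaw_pos (linAction S₀ D (c j))) hmass
    (sum_gibbsLaw _) D
  unfold varD
  rw [← lawVariance_eq_varLaw (sum_gibbsLaw _)]
  exact h

/-- **THE `χ²` RECURSION IS THE LAG RECURSION.**  If `|D x − D y| ≤ ΔD`, every layer `P k`
contracts `χ²` towards `π_{c_{k+1}}` with coefficient `ρ ≥ 0`, and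
`ρ·exp(|c_{k+1} − c_k|·ΔD/2) ≤ θ` for all `k`, then the `j`-th marginal satisfies
`√χ²(μ_j ‖ π_{c_j}) ≤ lagSeq θ d j` with the drops `d_k = |c_{k+1} − c_k|·√Var_{c_k}(D)`
(`e_0 = 0`, `e_{k+1} = θ(e_k + d_k)`, row 8's `lagSeq`). -/
theorem sqrt_chiSqDiv_evolveLaw_le_lagSeq [Nonempty X] (S₀ D : X → ℝ) (c : ℕ → ℝ)
    (P : ℕ → X → X → ℝ) (hP : ∀ k x, ∑ y, P k x y = 1) {ΔD ρ θ : ℝ}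
    (hD : ∀ x y, |D x - D y| ≤ ΔD)
    (hK : ∀ k, ChiSqContracts (P k) (gibbsLaw (linAction S₀ D (c (k + 1)))) ρ) (hρ : 0 ≤ ρ)
    (hθ : ∀ k, ρ * Real.exp (|c (k + 1) - c k| * ΔD / 2) ≤ θ) :
    ∀ j, Real.sqrt (chiSqDiv (evolveLaw P (gibbsLaw (linAction S₀ D (c 0))) j)
            (gibbsLaw (linAction S₀ D (c j))))
      ≤ lagSeq θ (fun k => |c (k + 1) - c k| * Real.sqrt (varD S₀ D (c k))) j
  | 0 => by simp [chiSqDiv_self_eq_zero]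
  | j + 1 => by
      have ih := sqrt_chiSqDiv_evolveLaw_le_lagSeq S₀ D c P hP hD hK hρ hθ j
      have hmass : ∑ y, evolveLaw P (gibbsLaw (linAction S₀ D (c 0))) j y = 1 := by
        rw [sum_evolveLaw P hP, sum_gibbsLaw]
      have hR0 : 0 ≤ Real.exp (|c (j + 1) - c j| * ΔD) := (Real.exp_pos _).le
      have hstep := sqrt_chiSqDiv_step_le (hK j) hρ hmass (gibbsLaw_pos (linAction S₀ D (c j)))
        (gibbsLaw_pos (linAction S₀ D (c (j + 1)))) hR0
        (gibbsLaw_linAction_le_exp_mul S₀ D hD (c j) (c (j + 1)))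
      have hsw := sqrt_chiSqDiv_gibbsLaw_linAction_le S₀ D hD (c j) (c (j + 1))
      have hsqrt : Real.sqrt (Real.exp (|c (j + 1) - c j| * ΔD))
          = Real.exp (|c (j + 1) - c j| * ΔD / 2) := by
        have e2 : Real.exp (|c (j + 1) - c j| * ΔD / 2) ^ 2 = Real.exp (|c (j + 1) - c j| * ΔD) := by
          rw [← Real.exp_nat_mul]; congr 1; push_cast; ring
        rw [← e2, Real.sqrt_sq (Real.exp_pos _).le]
      rw [hsqrt] at hstep
      have ha0 : 0 ≤ Real.sqrt (chiSqDiv (evolveLaw P (gibbsLaw (linAction S₀ D (c 0))) j)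
            (gibbsLaw (linAction S₀ D (c j)))) := Real.sqrt_nonneg _
      have hd0 : 0 ≤ |c (j + 1) - c j| * Real.sqrt (varD S₀ D (c j)) := by positivity
      have hρE : 0 ≤ ρ * Real.exp (|c (j + 1) - c j| * ΔD / 2) := by positivity
      rw [evolveLaw_succ, lagSeq_succ]
      calc Real.sqrt (chiSqDiv (stepLaw (P j) (evolveLaw P (gibbsLaw (linAction S₀ D (c 0))) j))
              (gibbsLaw (linAction S₀ D (c (j + 1)))))
          ≤ ρ * (Real.exp (|c (j + 1) - c j| * ΔD / 2)
                * Real.sqrt (chiSqDiv (evolveLaw P (gibbsLaw (linAction S₀ D (c 0))) j)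
                    (gibbsLaw (linAction S₀ D (c j))))
              + Real.exp (|c (j + 1) - c j| * ΔD / 2)
                * (|c (j + 1) - c j| * Real.sqrt (varD S₀ D (c j)))) :=
            hstep.trans (mul_le_mul_of_nonneg_left (add_le_add le_rfl hsw) hρ)
        _ = (ρ * Real.exp (|c (j + 1) - c j| * ΔD / 2))
              * (Real.sqrt (chiSqDiv (evolveLaw P (gibbsLaw (linAction S₀ D (c 0))) j)
                    (gibbsLaw (linAction S₀ D (c j))))
                + |c (j + 1) - c j| * Real.sqrt (varD S₀ D (c j))) := by ring
        _ ≤ θ * (Real.sqrt (chiSqDiv (evolveLaw P (gibbsLaw (linAction S₀ D (c 0))) j)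
                    (gibbsLaw (linAction S₀ D (c j))))
                + |c (j + 1) - c j| * Real.sqrt (varD S₀ D (c j))) :=
            mul_le_mul_of_nonneg_right (hθ j) (add_nonneg ha0 hd0)
        _ ≤ θ * (lagSeq θ (fun k => |c (k + 1) - c k| * Real.sqrt (varD S₀ D (c k))) j
                + |c (j + 1) - c j| * Real.sqrt (varD S₀ D (c j))) :=
            mul_le_mul_of_nonneg_left (add_le_add ih le_rfl) (hρE.trans (hθ j))

/-! ## Any grid: the lag-law bound -/

/-- **Any grid:** `|⟨W⟩ − ΔF − KL_qs| ≤ Σ_{j<n} d_j · lagSeq θ d j`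
(`d_k = |c_{k+1} − c_k|·√Var_{c_k}(D)`), under the hypotheses of
`sqrt_chiSqDiv_evolveLaw_le_lagSeq`. -/
theorem abs_layerDissipation_sub_qs_le [Nonempty X] (S₀ D : X → ℝ) (c : ℕ → ℝ)
    (P : ℕ → X → X → ℝ) (hP : ∀ k x, ∑ y, P k x y = 1) {ΔD ρ θ : ℝ}
    (hD : ∀ x y, |D x - D y| ≤ ΔD)
    (hK : ∀ k, ChiSqContracts (P k) (gibbsLaw (linAction S₀ D (c (k + 1)))) ρ) (hρ : 0 ≤ ρ)
    (hθ : ∀ k, ρ * Real.exp (|c (k + 1) - c k| * ΔD / 2) ≤ θ) (n : ℕ) :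
    |layerDissipation S₀ D c P n - qsDissipation S₀ D c n|
      ≤ ∑ j ∈ range n, (|c (j + 1) - c j| * Real.sqrt (varD S₀ D (c j)))
          * lagSeq θ (fun k => |c (k + 1) - c k| * Real.sqrt (varD S₀ D (c k))) j := by
  rw [layerDissipation_eq S₀ D c P hP n, add_sub_cancel_left]
  refine (abs_sum_le_sum_abs _ _).trans (sum_le_sum fun j _ => ?_)
  rw [abs_mul]
  have hlag := abs_layerLag_le S₀ D c P hP j
  have hchi := sqrt_chiSqDiv_evolveLaw_le_lagSeq S₀ D c P hP hD hK hρ hθ j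
  have hσ0 : 0 ≤ Real.sqrt (varD S₀ D (c j)) := Real.sqrt_nonneg _
  calc |c (j + 1) - c j| * |layerLag S₀ D c P j|
      ≤ |c (j + 1) - c j| * (lagSeq θ (fun k => |c (k + 1) - c k| * Real.sqrt (varD S₀ D (c k))) j
          * Real.sqrt (varD S₀ D (c j))) :=
        mul_le_mul_of_nonneg_left (hlag.trans (mul_le_mul_of_nonneg_right hchi hσ0))
          (abs_nonneg _)
    _ = |c (j + 1) - c j| * Real.sqrt (varD S₀ D (c j))
          * lagSeq θ (fun k => |c (k + 1) - c k| * Real.sqrt (varD S₀ D (c k))) j := by ring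

end Summit.Ventures.LatticeQCDFlow.Scaling
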